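import Summits.BirchSwinnertonDyer.Rank1Residual.X11b.Three.BDPValueSupplied
import Summits.BirchSwinnertonDyer.BirchSwinnertonDyer.Theses.ClassRecordThree
import HarnessLib

/-!
# Route `ClassRecordThree`, crux `HalvesAtThree` (item stmt-BirchSwinnertonDyer-19107) — the H2 half
# `Three.BDPValueAt₃` from THEOREM C typed, and the reduction of the item to its one open half H3

Cell `bsd-stepL` (run/shared/lean/pub/bsd-stepL/), seat `bsd-stepL-thmc-p1` (prover g0, D-0074 hands, 2026-08-26),
`--supports stmt-BirchSwinnertonDyer-19107` (route `route-BirchSwinnertonDyer-ClassRecordThree`, crux 3 = `HalvesAtThree`: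
for `E ∈ X11b` at `3`, on the loci (3 split ∧ (ram)) and (¬(ram) ∧ ρ̄ onto), the BDP value formula
`Three.BDPValueAt₃ W` (H2) and the main-conjecture divisibility `Three.IMCDivAt₃ W` (H3)). The sister crux
`KolyvaginRoadThree.HalvesTamAtThree` (item 19155) is `HalvesAtThree` with a Tamagawa binder and follows from it.

## What this file records in the kernel

1. **Vacuity off the locus.** `Three.BDPValueAt₃ W` and `Three.IMCDivAt₃ W` (X11b/Three/StepLHalves.lean) carry
   `ClassX11b W 3 → Surj W 3 → …` as INNER binders: both hold trivially for a curve whose mod-3 representation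
   is not surjective (`bdpValueAt₃_of_not_surj`, `imcDivAt₃_of_not_surj`). Hence `HalvesAtThree` is EQUIVALENT to
   its surjective form: for every `E ∈ X11b@3` with `ρ̄_{E,3}` onto and NOT (a (ram) witness ∧ non-split at 3),
   `BDPValueAt₃ W ∧ IMCDivAt₃ W` (`classRecordThree_halvesAtThree_iff`) — the per-locus split the planner keeps
   inside the signature, made explicit for layer 2.
2. **H2 from THEOREM C.** The cell's THEOREM C (PROOF-BDP §20, referee PASS `referee/VERDICT-THMC-g7.md`; its
   erratum-data twin THEOREM C♯ §21, PASS g19 ∕ g21) is, binder for binder, the frame-value statement `h12` of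
   the tree theorem `Three.bdpValueAt₃_of_frameValue` (X11b/Three/BDPValueSupplied.lean): over every X11b@3 Heegner
   datum and EVERY `ι'` inducing `𝔭`, ONE frame `(Ω_K ≠ 0, Ω_p ∈ R₀ˣ, L ∈ R₀⟦T⟧)` with Castella's interpolation
   property `IsBDPLFunction` AND `L(0) = u·((1 − a₃·3⁻¹)·log_{ω_E} P)²`, `u ∈ R₀ˣ`. Quantified over every curve
   (hypothesis `hC` below, stated INLINE — no definition, x11b3 R8-14 (e)), it gives the registered stub
   `stub_bdpValueAtThree` of the crux's BC3 skeleton on BOTH loci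
   (`classRecordThree_halvesAtThree_bdpValue_of_classicalFrameValue`) through `bdpValueAt₃_of_frameValue`
   (the tree's rigidity theorem `constantCoeff_eq_of_isBDPLFunction_of_supply` + the character supply
   `X11b.characterSupplyAt` carry the value of ONE frame to EVERY frame).
3. **The item reduced to H3.** Modulo THEOREM C typed, `HalvesAtThree` ⟸ H3 on the surjective locus
   (`classRecordThree_halvesAtThree_of_classicalFrameValue_of_imcDiv`) and ⟸ the registered stub shape
   `stub_imcDivAtThree` (`…_of_imcDivStub`); conversely `HalvesAtThree` ⟹ H3 on the locus
   (`imcDivAt₃_of_classRecordThree_halvesAtThree`). So, given THEOREM C, item 19107 IS the one open half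
   `Three.IMCDivAt₃` on {surj} ∖ {(ram) ∧ non-split(3)} — nothing in print at `p = 3` (EW16 tame datum vacuous at 3,
   [FW21] ∕ Wan need `p ≥ 5`; TARGET.md §1.1 H3).

HONEST FRAMING: every theorem here is an implication; THEOREM C is a MEMO theorem of the cell (refereed), NOT a
kernel theorem and NOT a Literature fact — its bricks (Castella–Hsieh 2018 Prop. 3.6 at `p ‖ N` with Hsieh's
Steinberg multiplier; Kriz–Li 2019 Lemma 2.6 ∕ Thm. 2.8 = Liu–Zhang–Zhang 2018 App. A Prop. A.1 re-routed to `E`;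
the proof of KL19 Thm. 2.9 at `χ = 𝟙`) live on the Katz-measure ∕ Igusa-tower ∕ Coleman-primitive definition front
the tree does not have. Nothing is discharged; no node, label or census count moves (T7); O2 stays OPEN.

References: [Castella2018] F. Castella, Camb. J. Math. 6 (2018) = arXiv:1704.06608, Thm. 3.1–3.2 (pp. 8–9), §5
(p. 12); [CastellaHsieh2018] Math. Ann. 370, §3.1–3.3, Def. 3.5, Prop. 3.6; [KrizLi2019] Forum Math. Sigma 7 e15,
§2 (Lemmas 2.4 ∕ 2.6, Thm. 2.8, proof of Thm. 2.9); [LiuZhangZhang2018] Duke Math. J. 167, App. A Prop. A.1;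
[Hsieh2014] Doc. Math. 19, Thm. 3.14 ∕ Prop. 3.5; cell memo PROOF-BDP v1.8 §20 (THEOREM C) ∕ v1.9 §21 (C♯);
HOME `bdp/TheoremC_Typed.lean` (the same binder as a HOME-only def `BdpSeat.classicalFrameValue₃`).
-/

noncomputable section

open scoped Classical Topology

open Filter WeierstrassCurve NumberField IsDedekindDomain Field PowerSeries
  Literature.NumberTheory.EllipticCurves Literature.NumberTheory.EllipticCurves.ModularForms
  Literature.NumberTheory.EllipticCurves.Rank1Residual
  Literature.NumberTheory.GaloisRepresentations Literature.NumberTheory.GaloisCohomology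
  Summit.BirchSwinnertonDyer.Rank1Residual Summit.BirchSwinnertonDyer.Rank1Residual.X11b
  Summit.BirchSwinnertonDyer.Rank1Residual.X11b.AcSelmer
  Summit.BirchSwinnertonDyer.Rank1Residual.X11b.CongruenceLimit
  Summit.BirchSwinnertonDyer.Rank1Residual.X11b.Halves
  Summit.BirchSwinnertonDyer.Rank1Residual.X11b.Three
  Summit.BirchSwinnertonDyer.BirchSwinnertonDyer.Theses.ClassRecordThree

namespace Summit.BirchSwinnertonDyer.BirchSwinnertonDyer.Theorems

/-! ## §1 Vacuity of the two halves off the surjective locus; `HalvesAtThree` in its locus form -/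

section Vacuity

variable (W : WeierstrassCurve ℚ) [W.IsElliptic] [W.IsGloballyMinimal]

/-- `Three.BDPValueAt₃ W` binds `Surj W 3` internally, so it holds trivially for a curve whose mod-3 Galois
representation is not surjective. [folklore] -/
theorem bdpValueAt₃_of_not_surj (h : ¬ Surj W 3) : BDPValueAt₃ W :=
  fun _ _ _ _ _ _ _ _ _ _ hsurj ↦ absurd hsurj h

omit [W.IsElliptic] [W.IsGloballyMinimal] in
/-- `Three.IMCDivAt₃ W` binds `Surj W 3` internally, so it holds trivially for a curve whose mod-3 Galois
representation is not surjective. [folklore] -/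
theorem imcDivAt₃_of_not_surj (h : ¬ Surj W 3) : IMCDivAt₃ W :=
  fun _ _ _ _ _ _ _ _ _ _ hsurj ↦ absurd hsurj h

/-- `Three.BDPValueAt₃ W` binds `ClassX11b W 3` internally, so it holds trivially off class X11b at 3.
[folklore] -/
theorem bdpValueAt₃_of_not_classX11b (h : ¬ ClassX11b W 3) : BDPValueAt₃ W :=
  fun _ _ _ _ _ _ _ _ _ hX ↦ absurd hX h

omit [W.IsElliptic] [W.IsGloballyMinimal] in
/-- `Three.IMCDivAt₃ W` binds `ClassX11b W 3` internally, so it holds trivially off class X11b at 3.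
[folklore] -/
theorem imcDivAt₃_of_not_classX11b (h : ¬ ClassX11b W 3) : IMCDivAt₃ W :=
  fun _ _ _ _ _ _ _ _ _ hX ↦ absurd hX h

end Vacuity

/-- **`HalvesAtThree` in locus form.** The crux is equivalent to: for every `E ∈ X11b` at 3 with `ρ̄_{E,3}`
surjective and NOT ((ram) witness ∧ non-split multiplicative reduction at 3), both halves `BDPValueAt₃ W` and
`IMCDivAt₃ W` hold — because both halves are vacuous off `Surj` (§1) and the two clauses of the crux cover
exactly (3 split ∧ (ram)) ∪ ¬(ram). The complementary X11b@3 population ((ram) ∧ non-split at 3) is road (a) =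
crux `SchneiderAtThree`; the non-surjective corner is crux `CornerAtThree`. [folklore] -/
theorem classRecordThree_halvesAtThree_iff :
    HalvesAtThree ↔
      ∀ (W : WeierstrassCurve ℚ) [W.IsElliptic] [W.IsGloballyMinimal], ClassX11b W 3 → Surj W 3 →
        ¬ (Ram W 3 ∧ ¬ W.HasSplitMultiplicativeReductionAtPrime 3) → BDPValueAt₃ W ∧ IMCDivAt₃ W := by
  unfold HalvesAtThree
  constructor
  · intro h W _ _ hX hsurj hloc
    obtain ⟨h₁, h₂⟩ := h W hX
    by_cases hr : Ram W 3
    · by_cases hs : W.HasSplitMultiplicativeReductionAtPrime 3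
      · exact h₁ hr hs
      · exact absurd ⟨hr, hs⟩ hloc
    · exact h₂ hr hsurj
  · intro h W _ _ hX
    refine ⟨fun hr hs ↦ ?_, fun hnr hsurj ↦ h W hX hsurj (fun hc ↦ hnr hc.1)⟩
    by_cases hsurj : Surj W 3
    · exact h W hX hsurj (fun hc ↦ hc.2 hs)
    · exact ⟨bdpValueAt₃_of_not_surj W hsurj, imcDivAt₃_of_not_surj W hsurj⟩

/-- The H3 content of `HalvesAtThree`, extracted: on the locus {surj} ∖ {(ram) ∧ non-split(3)} of X11b@3 the
crux gives the main-conjecture divisibility `Three.IMCDivAt₃ W`. [folklore] -/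
theorem imcDivAt₃_of_classRecordThree_halvesAtThree (h : HalvesAtThree) (W : WeierstrassCurve ℚ)
    [W.IsElliptic] [W.IsGloballyMinimal] (hX : ClassX11b W 3) (hsurj : Surj W 3)
    (hloc : ¬ (Ram W 3 ∧ ¬ W.HasSplitMultiplicativeReductionAtPrime 3)) : IMCDivAt₃ W :=
  (classRecordThree_halvesAtThree_iff.mp h W hX hsurj hloc).2

/-- The H2 content of `HalvesAtThree`, extracted: on the same locus the crux gives the BDP value formula
`Three.BDPValueAt₃ W`. [folklore] -/
theorem bdpValueAt₃_of_classRecordThree_halvesAtThree (h : HalvesAtThree) (W : WeierstrassCurve ℚ)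
    [W.IsElliptic] [W.IsGloballyMinimal] (hX : ClassX11b W 3) (hsurj : Surj W 3)
    (hloc : ¬ (Ram W 3 ∧ ¬ W.HasSplitMultiplicativeReductionAtPrime 3)) : BDPValueAt₃ W :=
  (classRecordThree_halvesAtThree_iff.mp h W hX hsurj hloc).1

/-! ## §2 THEOREM C typed (class-wide) ⟹ the H2 stub on both loci; the item reduced to H3 -/

section TheoremC

/- THEOREM C of the cell at `p = 3` (PROOF-BDP §20.1; erratum-data twin C♯ §21), TYPED = the binder `h12` of
`Three.bdpValueAt₃_of_frameValue` VERBATIM, quantified over every curve (it binds `ClassX11b W 3 → Surj W 3`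
itself, so off X11b@3-with-surjective-image it is empty): for every X11b@3 Heegner datum `(N, K, Dt, H, ι, P)`,
every anticyclotomic `(κ, γ)`, every degree-one `𝔭 ∋ 3`, the newform `f` of `E` and EVERY `ι' : ℚ̄₃ ≃ ℂ`
inducing `𝔭`, there is ONE frame `(Ω_K, Ω_p, L)` with `Ω_K ≠ 0`, Castella's interpolation property and the
value `L(0) = u·((1 − a₃(E)·3⁻¹)·log_{ω_E} P)²`, `u ∈ R₀ˣ` (`a₃(E) = W.LFunction 3 ∈ {±1}`). INLINE
hypothesis — no definition (the HOME-only def `BdpSeat.classicalFrameValue₃` is the same text); memo-proved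
and refereed, NOT a kernel theorem: everything in this section is conditional on it. -/
variable
  (hC : ∀ (W : WeierstrassCurve ℚ) [W.IsElliptic] [W.IsGloballyMinimal],
    ∀ (N : ℕ) [NeZero N] (K : Type) [Field K] [NumberField K] (Dt : ModularParametrizationData W N)
    (H : HeegnerDatum N (NumberField.discr K)) (ι : K →+* ℂ) (P : (W.baseChange K).toAffine.Point),
    ClassX11b W 3 → Surj W 3 → W.conductorNorm ℤ = N → IsImaginaryQuadratic K →
    Odd (NumberField.discr K) → SatisfiesHeegnerHypothesis N K →
    (W.quadraticTwist (NumberField.discr K : ℚ)).entireLFunction 1 ≠ 0 →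
    WeierstrassCurve.Affine.Point.map ι.toRatAlgHom P = heegnerPointComplex Dt H →
    ¬ (3 : ℤ) ∣ Dt.c → ¬ IsOfFinAddOrder P →
    ∀ (κ : ZpExtension K 3), κ.IsAnticyclotomic →
      ∀ (γ : Field.absoluteGaloisGroup K) [Fact (κ.IsTopGenerator γ)]
        (𝔭 : HeightOneSpectrum (𝓞 K)) (h𝔭 : ((3 : ℕ) : 𝓞 K) ∈ 𝔭.asIdeal)
        (he : 𝔭.asIdeal.ramificationIdx (𝓞 ℚ) = 1) (hf : 𝔭.asIdeal.inertiaDeg (𝓞 ℚ) = 1),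
        ∀ (f : CuspForm (CongruenceSubgroup.Gamma0 N) 2), IsNewformOf W f →
          ∀ (ι' : PadicAlgCl 3 ≃+* ℂ), InducesPrime ι' 𝔭 →
            ∃ (ΩK : ℂ) (Ωp : (unrIntegers 3)ˣ) (L : UnrSeries 3),
              ΩK ≠ 0 ∧ IsBDPLFunction ι' 𝔭 κ γ f ΩK ((Ωp : unrIntegers 3) : ℂ_[3]) L ∧
              ∃ u : (unrIntegers 3)ˣ, L.HasValueAt 0 (((u : unrIntegers 3) : ℂ_[3]) *
                (algebraMap ℚ_[3] ℂ_[3] (((1 : ℚ_[3]) - ((W.LFunction 3 : ℤ) : ℚ_[3]) * (3 : ℚ_[3])⁻¹) *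
                  logOmega W 3 (embAt K 3 𝔭 h𝔭 he hf) P)) ^ 2))

include hC in
/-- **THEOREM C typed ⟹ H2 of record for every curve**: `Three.BDPValueAt₃ W` (the ∀-frame value statement)
for every `W`, one line through `Three.bdpValueAt₃_of_frameValue` (S27′: the frame-value statement ALONE gives
H2 — rigidity `constantCoeff_eq_of_isBDPLFunction_of_supply` + `X11b.characterSupplyAt` at `p = 3`).
[cite: Castella2018, Thm. 3.2 (arXiv:1704.06608 p. 9) (shape only; the antecedent is PROOF-BDP §20 THEOREM C, a refereed memo theorem, not print at p = 3 ∣ N)] -/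
theorem bdpValueAt₃_of_classicalFrameValue (W : WeierstrassCurve ℚ) [W.IsElliptic] [W.IsGloballyMinimal] :
    BDPValueAt₃ W :=
  bdpValueAt₃_of_frameValue (hC W)

include hC in
/-- **THEOREM C typed ⟹ the H2 stub of crux `HalvesAtThree` on BOTH loci** — verbatim the registered stub
`stub_bdpValueAtThree` of the item's BC3 skeleton (`Cruxes/HalvesAtThree/Lines/birth.lean`, stubs registered
on stmt-BirchSwinnertonDyer-19107): for `E ∈ X11b` at 3, (ram) → 3 split → `BDPValueAt₃ W`, and ¬(ram) → surj →
`BDPValueAt₃ W`. The loci binders are not used: THEOREM C gives H2 for every X11b@3 curve with surjective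
image, and H2 is vacuous otherwise (§1). CONDITIONAL on THEOREM C typed (`hC`).
[cite: Castella2018, Thm. 3.2 (arXiv:1704.06608 p. 9) (shape only; antecedent = PROOF-BDP §20 THEOREM C)] -/
theorem classRecordThree_halvesAtThree_bdpValue_of_classicalFrameValue :
    ∀ (W : WeierstrassCurve ℚ) [W.IsElliptic] [W.IsGloballyMinimal],
      Summit.BirchSwinnertonDyer.Rank1Residual.ClassX11b W 3 →
        (Literature.NumberTheory.EllipticCurves.Rank1Residual.Ram W 3 →
            W.HasSplitMultiplicativeReductionAtPrime 3 →
              Summit.BirchSwinnertonDyer.Rank1Residual.X11b.Three.BDPValueAt₃ W) ∧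
          (¬ Literature.NumberTheory.EllipticCurves.Rank1Residual.Ram W 3 →
            Literature.NumberTheory.EllipticCurves.Rank1Residual.Surj W 3 →
              Summit.BirchSwinnertonDyer.Rank1Residual.X11b.Three.BDPValueAt₃ W) :=
  fun W _ _ _ ↦
    ⟨fun _ _ ↦ bdpValueAt₃_of_classicalFrameValue hC W, fun _ _ ↦ bdpValueAt₃_of_classicalFrameValue hC W⟩

include hC in
/-- **The item reduced to its one open half.** Modulo THEOREM C typed, the crux `HalvesAtThree` follows from
H3 = `Three.IMCDivAt₃ W` (the one-sided anticyclotomic main-conjecture divisibility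
`Ch_Λ(X_ac)·R₀⟦T⟧ ⊆ (L)` at `p = 3 ∥ N`) on the locus {`E ∈ X11b@3`, `ρ̄_{E,3}` onto} ∖ {(ram) ∧ non-split at 3}.
H3 is OPEN (nothing in print at `p = 3`); it is the hypothesis `h3`. Nothing is discharged.
[cite: Castella2018, §1 (1.b) (arXiv:1704.06608 p. 3) and Thm. 3.3 (p. 9) (shape of H3 only; open at p = 3)] -/
theorem classRecordThree_halvesAtThree_of_classicalFrameValue_of_imcDiv
    (h3 : ∀ (W : WeierstrassCurve ℚ) [W.IsElliptic] [W.IsGloballyMinimal], ClassX11b W 3 → Surj W 3 →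
      ¬ (Ram W 3 ∧ ¬ W.HasSplitMultiplicativeReductionAtPrime 3) → IMCDivAt₃ W) :
    HalvesAtThree :=
  classRecordThree_halvesAtThree_iff.mpr fun W _ _ hX hsurj hloc ↦
    ⟨bdpValueAt₃_of_classicalFrameValue hC W, h3 W hX hsurj hloc⟩

include hC in
/-- **The item reduced to the registered H3 stub.** Modulo THEOREM C typed, `HalvesAtThree` follows from the
two-loci H3 statement — verbatim the registered stub `stub_imcDivAtThree` of the BC3 skeleton ((ram) → 3 split
→ `IMCDivAt₃ W`; ¬(ram) → surj → `IMCDivAt₃ W`). This is the skeleton's composition `HalvesAtThree_of` with its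
H2 stub supplied by THEOREM C. H3 is OPEN; nothing is discharged.
[cite: Castella2018, Thm. 3.3 (arXiv:1704.06608 p. 9) (shape of H3 only; open at p = 3)] -/
theorem classRecordThree_halvesAtThree_of_classicalFrameValue_of_imcDivStub
    (h3 : ∀ (W : WeierstrassCurve ℚ) [W.IsElliptic] [W.IsGloballyMinimal], ClassX11b W 3 →
      (Ram W 3 → W.HasSplitMultiplicativeReductionAtPrime 3 → IMCDivAt₃ W) ∧
        (¬ Ram W 3 → Surj W 3 → IMCDivAt₃ W)) :
    HalvesAtThree := by
  unfold HalvesAtThree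
  intro W _ _ hX
  obtain ⟨hI₁, hI₂⟩ := h3 W hX
  exact ⟨fun hr hs ↦ ⟨bdpValueAt₃_of_classicalFrameValue hC W, hI₁ hr hs⟩,
    fun hnr hsu ↦ ⟨bdpValueAt₃_of_classicalFrameValue hC W, hI₂ hnr hsu⟩⟩

end TheoremC

end Summit.BirchSwinnertonDyer.BirchSwinnertonDyer.Theorems

end
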